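import Mathlib

/-!
# PercRepro — the arithmetic of the triangle table's closed form: (L1) superadditivity and (L2) (p3, gen 23)

`P_KK(ν) = C(k,3) + C(j,2)` for `ν = C(k−1,2) + j − 1`, `1 ≤ j ≤ k` (P3-TRIANGLE-CAP.md §10b) is the prefix
sum of the increment sequence `s = (1)(1,2)(1,2,3)…` (runs `R_t = (1, …, t)`, §10f / §10i / §10k). Here `s` is
generated by a two-counter machine `st` (run index, offset), `P n = Σ_{m<n} s (m+1)`, and ONE window lemma —
a window of length `ℓ ≤ t` whose first position lies in a run `R_{t'}` with `t' ≥ t` sums to at least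
`tri ℓ = 1 + ⋯ + ℓ` (`window_sum`) — gives
* **(L1)** `P a + P b ≤ P (a + b)` (`P_superadd`: strong induction on `b`, peeling the last partial run of `b`);
* **(L2)** `tri D + P (ν − D) ≤ P ν` for `tri D ≤ ν` (`P_window_tail`), i.e. `C(d,2) + P(ν − d + 1) ≤ P(ν)` for
  `ν ≥ C(d,2)` (`L2`, with `D = d − 1`);
* the closed form `P (tri t + i) = C(t+2,3) + C(i+1,2)` for `i ≤ t + 1` (`P_closed`; `k = t + 2`, `j = i + 1`).
These are the two arithmetic lemmas of the vertex-deletion proof of the GRAPHIC closed form `T(G) ≤ P_KK(ν(G))`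
(§10f / §10i); the graph theorem itself is NOT formalised here. Axioms: standard.
-/

namespace PercRepro

namespace TriangleCap

namespace KK

open Finset

/-- `tri n = 1 + 2 + ⋯ + n` (`= C(n+1, 2)`, `tri_eq_choose`). -/
def tri (n : ℕ) : ℕ := ∑ j ∈ range n, (j + 1)

/-- `tri (n + 1) = tri n + (n + 1)`. -/
theorem tri_succ (n : ℕ) : tri (n + 1) = tri n + (n + 1) := by
  unfold tri; rw [sum_range_succ]

/-- `tri 0 = 0`. -/
theorem tri_zero : tri 0 = 0 := by simp [tri]

/-- `tri` is monotone. -/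
theorem tri_mono {a b : ℕ} (h : a ≤ b) : tri a ≤ tri b := by
  induction h with
  | refl => exact le_rfl
  | step _ ih => rw [tri_succ]; omega

/-- `n ≤ tri n`. -/
theorem le_tri (n : ℕ) : n ≤ tri n := by
  induction n with
  | zero => simp [tri_zero]
  | succ n ih => rw [tri_succ]; omega

/-- `tri n = C(n+1, 2)`. -/
theorem tri_eq_choose (n : ℕ) : tri n = (n + 1).choose 2 := by
  have h2 : tri n * 2 = (n + 1) * n := by
    induction n with
    | zero => simp [tri_zero]
    | succ n ih => rw [tri_succ, Nat.add_mul, ih]; ring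
  rw [Nat.choose_two_right, Nat.add_sub_cancel]
  exact (Nat.div_eq_of_eq_mul_left (by norm_num) h2.symm).symm

/-- The two-counter machine: `st n = (t, i)` — position `n ≥ 1` is the `i`-th entry of the run `R_t`
(`st 0 = (1, 0)` is the state before the first run). -/
def st : ℕ → ℕ × ℕ
  | 0 => (1, 0)
  | n + 1 => if (st n).2 < (st n).1 then ((st n).1, (st n).2 + 1) else ((st n).1 + 1, 1)

/-- The increment sequence `s n = (st n).2`: `1, 1, 2, 1, 2, 3, 1, 2, 3, 4, …` (positions `1, 2, 3, …`). -/
def s (n : ℕ) : ℕ := (st n).2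

/-- `P n = Σ_{m=1}^{n} s m` — the table `P_KK`: `P 8 = 13`, `P 9 = 16`, `P 10 = 20`, `P 15 = 35`. -/
def P (n : ℕ) : ℕ := ∑ m ∈ range n, s (m + 1)

/-- One step inside a run. -/
theorem st_succ_of_lt {n : ℕ} (h : (st n).2 < (st n).1) : st (n + 1) = ((st n).1, (st n).2 + 1) := by
  simp [st, h]

/-- One step at the end of a run. -/
theorem st_succ_of_eq {n : ℕ} (h : (st n).2 = (st n).1) : st (n + 1) = ((st n).1 + 1, 1) := by
  simp [st, h]

/-- The invariant of the machine: `1 ≤ t`, `i ≤ t`, and `tri (t − 1) + i = n`. -/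
theorem st_inv (n : ℕ) : 1 ≤ (st n).1 ∧ (st n).2 ≤ (st n).1 ∧ tri ((st n).1 - 1) + (st n).2 = n := by
  induction n with
  | zero => simp [st, tri_zero]
  | succ n ih =>
    obtain ⟨h1, h2, h3⟩ := ih
    rcases Nat.lt_or_ge (st n).2 (st n).1 with h | h
    · rw [st_succ_of_lt h]; dsimp only; exact ⟨h1, by omega, by omega⟩
    · have he : (st n).2 = (st n).1 := le_antisymm h2 h
      rw [st_succ_of_eq he]; dsimp only
      refine ⟨by omega, by omega, ?_⟩
      have ht : tri (st n).1 = tri ((st n).1 - 1) + (st n).1 := by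
        obtain ⟨k, hk⟩ : ∃ k, (st n).1 = k + 1 := ⟨(st n).1 - 1, by omega⟩
        rw [hk, tri_succ, Nat.add_sub_cancel]
      rw [Nat.add_sub_cancel]
      omega

/-- The offset never exceeds the run index. -/
theorem st_snd_le (n : ℕ) : (st n).2 ≤ (st n).1 := (st_inv n).2.1

/-- Positions `≥ 1` have offset `≥ 1`. -/
theorem st_snd_pos (n : ℕ) : 1 ≤ (st (n + 1)).2 := by
  rcases Nat.lt_or_ge (st n).2 (st n).1 with h | h
  · rw [st_succ_of_lt h]; dsimp only; omega
  · rw [st_succ_of_eq (le_antisymm (st_snd_le n) h)]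

/-- Moving `j` steps inside a run. -/
theorem st_add (n j : ℕ) (h : (st n).2 + j ≤ (st n).1) : st (n + j) = ((st n).1, (st n).2 + j) := by
  induction j with
  | zero => simp
  | succ j ih =>
    have hj : (st n).2 + j ≤ (st n).1 := by omega
    have hlt : (st (n + j)).2 < (st (n + j)).1 := by rw [ih hj]; dsimp only; omega
    rw [← Nat.add_assoc, st_succ_of_lt hlt, ih hj]
    simp [Nat.add_assoc]

/-- The first entry of the run `R_{t+1}` sits at position `tri t + 1`. -/
theorem st_tri_succ (t : ℕ) : st (tri t + 1) = (t + 1, 1) := by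
  induction t with
  | zero => simp [tri_zero, st]
  | succ t ih =>
    have h1 : st (tri t + 1 + t) = (t + 1, 1 + t) := by
      have := st_add (tri t + 1) t (by rw [ih]; dsimp only; omega)
      rw [ih] at this
      exact this
    have h2 : st (tri t + 1 + t + 1) = (t + 1 + 1, 1) := by
      have hc : (st (tri t + 1 + t)).2 = (st (tri t + 1 + t)).1 := by rw [h1]; dsimp only; omega
      have := st_succ_of_eq hc
      rw [h1] at this
      exact this
    have h3 : tri (t + 1) + 1 = tri t + 1 + t + 1 := by rw [tri_succ]; omega
    rw [h3, h2]

/-- A position beyond `tri T` lies in a run of index `≥ T + 1`. -/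
theorem run_ge (T x : ℕ) (h : tri T ≤ x) : T + 1 ≤ (st (x + 1)).1 := by
  by_contra hcon
  have hlt : (st (x + 1)).1 < T + 1 := Nat.lt_of_not_le hcon
  obtain ⟨h1, h2, h3⟩ := st_inv (x + 1)
  obtain ⟨u, hu⟩ : ∃ u, (st (x + 1)).1 = u + 1 := ⟨(st (x + 1)).1 - 1, by omega⟩
  have hm : tri (u + 1) ≤ tri T := tri_mono (by omega)
  rw [tri_succ] at hm
  rw [hu] at h2
  rw [hu, Nat.add_sub_cancel] at h3
  omega

/-- `P (n + ℓ) = P n + Σ_{j<ℓ} s (n + 1 + j)`. -/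
theorem P_add (n ℓ : ℕ) : P (n + ℓ) = P n + ∑ j ∈ range ℓ, s (n + 1 + j) := by
  unfold P
  rw [sum_range_add]
  congr 1
  apply sum_congr rfl
  intro j _
  rw [show n + j + 1 = n + 1 + j by omega]

/-- The first `ℓ ≤ t + 1` entries of the run `R_{t+1}` are `1, …, ℓ`: `P (tri t + ℓ) = P (tri t) + tri ℓ`. -/
theorem P_tri_add (t ℓ : ℕ) (h : ℓ ≤ t + 1) : P (tri t + ℓ) = P (tri t) + tri ℓ := by
  rw [P_add]
  congr 1
  show ∑ j ∈ range ℓ, s (tri t + 1 + j) = ∑ j ∈ range ℓ, (j + 1)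
  apply sum_congr rfl
  intro j hj
  rw [mem_range] at hj
  unfold s
  have := st_add (tri t + 1) j (by rw [st_tri_succ]; dsimp only; omega)
  rw [st_tri_succ] at this
  rw [this]
  dsimp only
  omega

/-- **THE WINDOW LEMMA.** A window of length `ℓ ≤ t` whose first position `x + 1` lies in a run of index
`≥ t` sums to at least `tri ℓ = 1 + ⋯ + ℓ`: inside one run the entries are `ℓ` consecutive integers `≥ 1`;
straddling two runs `R_{t'}, R_{t'+1}` (`t' ≥ t ≥ ℓ`, so never three) the window holds the last `y` entries of
`R_{t'}` (termwise `≥ ℓ − y + 1, …, ℓ`) and the first `ℓ − y` of `R_{t'+1}` (`= 1, …, ℓ − y`). -/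
theorem window_sum (t ℓ x : ℕ) (hℓ : ℓ ≤ t) (hx : t ≤ (st (x + 1)).1) :
    tri ℓ ≤ ∑ j ∈ range ℓ, s (x + 1 + j) := by
  obtain ⟨t', o, hto⟩ : ∃ t' o, st (x + 1) = (t', o) := ⟨_, _, rfl⟩
  have ht' : t ≤ t' := by rw [hto] at hx; exact hx
  have ho1 : 1 ≤ o := by have := st_snd_pos x; rw [hto] at this; exact this
  have hot : o ≤ t' := by have := st_snd_le (x + 1); rw [hto] at this; exact this
  have hadd : ∀ j, o + j ≤ t' → st (x + 1 + j) = (t', o + j) := by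
    intro j hj
    have := st_add (x + 1) j (by rw [hto]; dsimp only; omega)
    rw [hto] at this
    exact this
  rcases Nat.lt_or_ge (t' - o + 1) ℓ with hcase | hcase
  · -- straddling `R_{t'}` and `R_{t'+1}`: `y = t' − o + 1` entries left in `R_{t'}`
    set y := t' - o + 1 with hy
    have hs1 : ∀ j ∈ range y, s (x + 1 + j) = o + j := by
      intro j hj
      rw [mem_range] at hj
      unfold s
      rw [hadd j (by omega)]
    have hstart : st (x + 1 + y) = (t' + 1, 1) := by
      have hlast : st (x + 1 + (y - 1)) = (t', t') := by
        rw [hadd (y - 1) (by omega)]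
        congr 1
        omega
      have hc : (st (x + 1 + (y - 1))).2 = (st (x + 1 + (y - 1))).1 := by rw [hlast]
      have := st_succ_of_eq hc
      rw [hlast] at this
      rw [show x + 1 + y = x + 1 + (y - 1) + 1 by omega]
      exact this
    have hs2 : ∀ j ∈ range (ℓ - y), s (x + 1 + (y + j)) = 1 + j := by
      intro j hj
      rw [mem_range] at hj
      unfold s
      have := st_add (x + 1 + y) j (by rw [hstart]; dsimp only; omega)
      rw [hstart] at this
      rw [show x + 1 + (y + j) = x + 1 + y + j by omega, this]
    have hsplit : ℓ = y + (ℓ - y) := by omega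
    have hsum : ∑ j ∈ range ℓ, s (x + 1 + j)
        = (∑ j ∈ range y, (o + j)) + ∑ j ∈ range (ℓ - y), (1 + j) := by
      conv_lhs => rw [hsplit]
      rw [sum_range_add, sum_congr rfl hs1, sum_congr rfl hs2]
    have e1 : ℓ = (ℓ - y) + y := by omega
    have htri : tri ℓ = (∑ j ∈ range (ℓ - y), (j + 1)) + ∑ j ∈ range y, ((ℓ - y) + j + 1) := by
      conv_lhs => rw [e1]
      unfold tri
      rw [sum_range_add]
    rw [htri, hsum, add_comm (∑ j ∈ range y, (o + j))]
    apply add_le_add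
    · apply sum_le_sum; intro j _; omega
    · apply sum_le_sum; intro j _; omega
  · -- inside the run `R_{t'}`
    have hs : ∀ j ∈ range ℓ, s (x + 1 + j) = o + j := by
      intro j hj
      rw [mem_range] at hj
      unfold s
      rw [hadd j (by omega)]
    rw [sum_congr rfl hs]
    unfold tri
    apply sum_le_sum
    intro j _
    omega
/-- **(L1) — superadditivity of the table:** `P a + P b ≤ P (a + b)`. Strong induction on `b`: write
`b = tri (t' − 1) + ℓ` (the last, partial run of `b`, `1 ≤ ℓ ≤ t'`); then `P b = P (tri (t' − 1)) + tri ℓ`,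
while the window of length `ℓ` after position `a + tri (t' − 1)` lies in runs of index `≥ t'` and sums to
`≥ tri ℓ` (`window_sum`). -/
theorem P_superadd (a b : ℕ) : P a + P b ≤ P (a + b) := by
  induction b using Nat.strong_induction_on generalizing a with
  | _ b ih =>
  rcases Nat.eq_zero_or_pos b with hb | hb
  · subst hb; simp [P]
  · obtain ⟨t', ℓ, hst⟩ : ∃ t' ℓ, st b = (t', ℓ) := ⟨_, _, rfl⟩
    have hinv := st_inv b
    rw [hst] at hinv
    dsimp only at hinv
    obtain ⟨ht1, hℓt, hb_eq⟩ := hinv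
    have hℓ1 : 1 ≤ ℓ := by
      obtain ⟨b', rfl⟩ : ∃ b', b = b' + 1 := ⟨b - 1, by omega⟩
      have := st_snd_pos b'
      rw [hst] at this
      exact this
    obtain ⟨T, hT⟩ : ∃ T, t' = T + 1 := ⟨t' - 1, by omega⟩
    rw [hT, Nat.add_sub_cancel] at hb_eq
    have hcb : tri T < b := by omega
    have hPb : P b = P (tri T) + tri ℓ := by
      rw [← hb_eq]
      exact P_tri_add T ℓ (by omega)
    have hwin : tri ℓ ≤ ∑ j ∈ range ℓ, s (a + tri T + 1 + j) := by
      apply window_sum t' ℓ (a + tri T) hℓt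
      rw [hT]
      exact run_ge T (a + tri T) (by omega)
    have hPab : P (a + b) = P (a + tri T) + ∑ j ∈ range ℓ, s (a + tri T + 1 + j) := by
      rw [← hb_eq, ← Nat.add_assoc, P_add]
    have hih := ih (tri T) hcb a
    rw [hPab, hPb]
    omega

/-- **(L2), window form:** `tri D + P (ν − D) ≤ P ν` whenever `tri D ≤ ν` — the window `[ν − D + 1, ν]` of
length `D` lies in runs of index `≥ D` and sums to `≥ tri D`. -/
theorem P_window_tail (D ν : ℕ) (h : tri D ≤ ν) : tri D + P (ν - D) ≤ P ν := by
  rcases Nat.eq_zero_or_pos D with hD | hD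
  · subst hD; simp [tri_zero]
  · obtain ⟨T, hT⟩ : ∃ T, D = T + 1 := ⟨D - 1, by omega⟩
    have hDν : D ≤ ν := le_trans (le_tri D) h
    have hwin : tri D ≤ ∑ j ∈ range D, s (ν - D + 1 + j) := by
      apply window_sum D D (ν - D) le_rfl
      rw [hT]
      apply run_ge
      have := h
      rw [hT, tri_succ] at this
      omega
    have hP : P ν = P (ν - D) + ∑ j ∈ range D, s (ν - D + 1 + j) := by
      rw [← P_add, Nat.sub_add_cancel hDν]
    omega

/-- **(L2) in the paper's form:** for `d ≥ 1` and `ν ≥ C(d,2)`: `C(d,2) + P (ν − (d − 1)) ≤ P ν`. -/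
theorem L2 (d ν : ℕ) (hd : 1 ≤ d) (h : d.choose 2 ≤ ν) : d.choose 2 + P (ν - (d - 1)) ≤ P ν := by
  have e : tri (d - 1) = d.choose 2 := by rw [tri_eq_choose, Nat.sub_add_cancel hd]
  rw [← e]
  exact P_window_tail (d - 1) ν (by rw [e]; exact h)

/-- `P (tri t) = Σ_{u<t} tri (u + 1)` (the full runs `R_1, …, R_t`). -/
theorem P_tri (t : ℕ) : P (tri t) = ∑ u ∈ range t, tri (u + 1) := by
  induction t with
  | zero => simp [P, tri_zero]
  | succ t ih => rw [tri_succ, P_tri_add t (t + 1) le_rfl, ih, sum_range_succ]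

/-- The hockey stick `Σ_{u<t} C(u+2, 2) = C(t+2, 3)`. -/
theorem sum_choose_two (t : ℕ) : ∑ u ∈ range t, (u + 1 + 1).choose 2 = (t + 2).choose 3 := by
  induction t with
  | zero => simp
  | succ t ih =>
    rw [sum_range_succ, ih]
    have h : (t + 3).choose 3 = (t + 2).choose 2 + (t + 2).choose 3 := Nat.choose_succ_succ' (t + 2) 2
    show (t + 2).choose 3 + (t + 2).choose 2 = (t + 3).choose 3
    omega

/-- **THE CLOSED FORM:** `P (tri t + i) = C(t+2, 3) + C(i+1, 2)` for `i ≤ t + 1` — the paper's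
`P_KK(ν) = C(k,3) + C(j,2)` at `ν = C(k−1,2) + j − 1`, with `k = t + 2`, `j = i + 1`. -/
theorem P_closed (t i : ℕ) (hi : i ≤ t + 1) : P (tri t + i) = (t + 2).choose 3 + (i + 1).choose 2 := by
  rw [P_tri_add t i hi, P_tri, tri_eq_choose i]
  congr 1
  rw [← sum_choose_two]
  apply sum_congr rfl
  intro u _
  exact tri_eq_choose (u + 1)

/-- The census rows: `P 8 = 13`, `P 9 = 16`, `P 10 = 20`, `P 15 = 35` (§10b). -/
theorem P_values : P 8 = 13 ∧ P 9 = 16 ∧ P 10 = 20 ∧ P 15 = 35 := by decide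

end KK

end TriangleCap

end PercRepro
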